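import Mathlib
import Literature.Analysis.FluidPDE.Tao2016AveragedNS.ShiftSetCascadeFlows
import Literature.Analysis.FluidPDE.Tao2016AveragedNS.ShiftSetCascadeFlux
import Summits.NavierStokesRegularity.NavierStokesRegularity.Theorems.TaoLadderRungTwoFlatCertificateGlueCheckerBranchGenOn
import Summits.NavierStokesRegularity.NavierStokesRegularity.Theorems.TaoLadderRungTwoFlatCertificateGlueJacobianVarMatOn
import HarnessLib

/-!
# Certificate glue on a shift set `𝕊`, XXXVIII-d: THE STEP / BRANCH / CHAIN CHECKERS WITH THE SPARSE-JACOBIAN FRAME ENCLOSURE — glue XXVII-e / XXVIII-e /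
  XXIX-d (`stepCert_of_checksG`, `stepCert_of_recG`, `checkStepG`, `stepCert_of_checkStepG`, `transitBranchG_of_checks`, `htrap_of_chainChecksG`) with
  the per-column variational jets `vcolsA` replaced by the all-directions table `vcolsJ` of glue XXXVIII-c; every conclusion is VERBATIM that of the
  `…G` twin (helper for items stmt-NavierStokesRegularity-22987 `FlatGapCertificatesV2` (crux K_A♭ of route TaoLadderRungTwoFlat) and stmt-24295 K_A₂(64);
  cell harvest/h2-tao-ladder, p1 g18; PERFORMANCE refactor: farm timing on the layout-V record hop9_A j = 1 (n = 98, p = 16, prec = 64): the FULL frame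
  enclosure `kappaArr ∘ vcolsJ` (98 columns) + hull jets = 165 s wall, against ≈ 18 s PER COLUMN (4 columns + hull jets = 148 s) for `vcolsA`)

* `kappa_of_kappaArrJ` — the frame enclosure `κ` of glue XXVI-b `kappa_of_kappaArr` computed against `vcolsJ`;
* `checkStepGJ` — `checkStepG` with `vcolsA ↦ vcolsJ` inside the C8vr test, SAME conjunct layout (so every projection pattern of the `…G` consumers applies);
* `stepCert_of_checksGJ` / `stepCert_of_recGJ` / `stepCert_of_checkStepGJ` / `transitBranchGJ_of_checks` / `htrap_of_chainChecksGJ` — the twins.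

HONEST FRAMING: Tao-type MODEL lattices (Tao 2016 §4/§6 vocabulary, shift-set parametrised); soundness of a checker — NO certificate instance exists in the
tree, nothing is certified here, no stub is closed, nothing here is a statement about the Navier–Stokes equations.
-/

-- the sub-problem namespace repeats the summit name by design (D-0017)
set_option linter.dupNamespace false

namespace Summit.NavierStokesRegularity.NavierStokesRegularity.Theorems

open Set Finset Literature.Analysis.FluidPDE Literature.Analysis.FluidPDE.TaoCascade
open Summit.NavierStokesRegularity.NavierStokesRegularity.Theorems.TaylorModelCert
open Summit.NavierStokesRegularity.NavierStokesRegularity.Theorems.TaylorModelReadout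

namespace CertificateGlueOn

/-! ### The frame enclosure against `vcolsJ` -/

section Kappa

variable {m : ℕ} {Kb Ka : ℤ} {ω : Fin m → ℤ → ℝ} {ε₀ : ℝ} {α : Fin m → Fin m → Fin m → ℤ × ℤ × ℤ → ℝ}
  {shifts : List (ℤ × ℤ × ℤ)} {prec : ℕ} {coefB : Fin m → ℤ → Fin m → Fin m → ℤ × ℤ × ℤ → IntervalD}

/-- **The frame enclosure**: for every `z` in the hull box and `ξ` in the `r`-box, `|VPoly(z)(C ξ)_c − (Cn T ξ)_c| ≤ κ_c` where
`κ = kappaArr` against the variational columns `[V C] = vcolsJ` over the HULL box — the hypothesis `hκ` of glue XVIII-c / XIX-h.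
[cite: Zgliczynski2002C1Lohner, §3–4 (Lohner-type parallelepiped frames: mean-value form); cell certificate format, checker clauses] -/
theorem kappa_of_kappaArrJ (hKb : 0 ≤ Kb) (hKa : 1 ≤ Ka) (hnd : shifts.Nodup) (hcoef : CoefBoxOK shifts ε₀ α Kb Ka ω coefB) (p : ℕ)
    (xD ρD ED : Array Dyad) {H : IntervalD} {u : ℝ} (hu : IntervalD.mem u H) (C Cn T : Array (Array Dyad)) (rD : Array Dyad) :
    ∀ z : Fin (m * winLen Kb Ka) → ℝ,
      (∀ d, |z d - dvec (n := m * winLen Kb Ka) xD d| ≤ dvec (n := m * winLen Kb Ka) ρD d + dvec (n := m * winLen Kb Ka) ED d) →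
      ∀ ξ : Fin (m * winLen Kb Ka) → ℝ, (∀ c, |ξ c| ≤ dvec (n := m * winLen Kb Ka) rD c) →
      ∀ c, |(VPoly (PQcN shifts.toFinset ε₀ α Kb Ka ω) p z ((dmat (n := m * winLen Kb Ka) C).mulVec ξ) u -
          (dmat (n := m * winLen Kb Ka) Cn).mulVec ((dmat (n := m * winLen Kb Ka) T).mulVec ξ)) c| ≤
        (dgetD (kappaArr prec (m * winLen Kb Ka) Cn T
          (vcolsJ Kb Ka prec shifts coefB p (IntervalD.jetLevelsA (m * winLen Kb Ka) (pqBoxA Kb Ka prec shifts coefB) prec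
            (hullBoxA (m * winLen Kb Ka) xD ρD ED) p) H C) rD) c).toReal := by
  intro z hz ξ hξ c
  have hsz : (c : ℕ) < (kappaArr prec (m * winLen Kb Ka) Cn T
      (vcolsJ Kb Ka prec shifts coefB p (IntervalD.jetLevelsA (m * winLen Kb Ka) (pqBoxA Kb Ka prec shifts coefB) prec
        (hullBoxA (m * winLen Kb Ka) xD ρD ED) p) H C) rD).size := by
    simp only [kappaArr, Array.size_ofFn]; exact c.isLt
  unfold dgetD
  rw [dif_pos hsz]
  simp only [kappaArr, Array.getElem_ofFn]
  rw [VPoly_mulVec isLinearMap_PQcN_right isLinearMap_PQcN_left, Matrix.mulVec_mulVec, ← Matrix.sub_mulVec]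
  -- as a row of `−(Cn T − W(z))`
  have hrow : ((wMat (PQcN shifts.toFinset ε₀ α Kb Ka ω) p z (dmat (n := m * winLen Kb Ka) C) u -
      dmat (n := m * winLen Kb Ka) Cn * dmat (n := m * winLen Kb Ka) T).mulVec ξ) c =
      -∑ j : Fin (m * winLen Kb Ka), ((dmat (n := m * winLen Kb Ka) Cn * dmat (n := m * winLen Kb Ka) T) c j -
        wMat (PQcN shifts.toFinset ε₀ α Kb Ka ω) p z (dmat (n := m * winLen Kb Ka) C) u c j) * ξ j := by
    simp only [Matrix.mulVec, dotProduct, Matrix.sub_apply, ← Finset.sum_neg_distrib]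
    exact Finset.sum_congr rfl fun j _ => by ring
  rw [hrow, abs_neg]
  refine abs_sum_le_rowMagDot
    (A := fun c j => (dmat (n := m * winLen Kb Ka) Cn * dmat (n := m * winLen Kb Ka) T) c j -
      wMat (PQcN shifts.toFinset ε₀ α Kb Ka ω) p z (dmat (n := m * winLen Kb Ka) C) u c j)
    (B := kEntry prec (m * winLen Kb Ka) Cn T
      (vcolsJ Kb Ka prec shifts coefB p (IntervalD.jetLevelsA (m * winLen Kb Ka) (pqBoxA Kb Ka prec shifts coefB) prec
        (hullBoxA (m * winLen Kb Ka) xD ρD ED) p) H C)) (c := c) (fun j => ?_) hξ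
  unfold kEntry
  refine IntervalD.mem_subR prec ?_ (mem_wMatJ hKb hKa hnd hcoef p (by simp [hullBoxA]) (mem_hullBoxA xD ρD ED hz) hu C c j)
  rw [Matrix.mul_apply]
  refine mem_ipvEntry prec Cn (fun d => ?_) c
  unfold colBoxA
  rw [IntervalD.aget_ofFn _ d.isLt]
  exact IntervalD.mem_ofDyad _

end Kappa

variable {m : ℕ} {Kb Ka : ℤ}

/-! ### The step checker over a generic table, sparse-Jacobian frame enclosure -/

/-- **THE VECTOR-LAYOUT STEP CHECKER OVER A GENERIC COEFFICIENT-BOX TABLE IS SOUND** (glue XXVII-d `stepCert_of_checksVR` with `coefBoxOf prec αq ωq Sp Sm`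
replaced by any `cB` with `CoefBoxOK` — e.g. the tabulated `coefLookup` of glue XXV-m). [cite: Zgliczynski2002C1Lohner, §3–4 (Lohner-type parallelepiped frames and the C¹/variational enclosure); cell certificate format, Lohner step, vector remainder] -/
theorem stepCert_of_checksGJ (hKb : 0 ≤ Kb) (hKa : 1 ≤ Ka) {shifts : List (ℤ × ℤ × ℤ)} (hnd : shifts.Nodup)
    (h𝕊 : IsNearestNeighbourSet shifts.toFinset) {q : ℚ} (hq : 0 < 1 + (q : ℝ))
    {αq : Fin m → Fin m → Fin m → ℤ × ℤ × ℤ → ℚ} {ωq : Fin m → ℤ → ℚ} (hω : ∀ i k, 0 < ωq i k)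
    {prec p kexp nexp : ℕ} {Sp Sm : IntervalD} (hSp : sqrtCheck prec (1 + q) Sp = true)
    (hSm : sqrtCheck prec (1 / (1 + q)) Sm = true) {cB : Fin m → ℤ → Fin m → Fin m → ℤ × ℤ × ℤ → IntervalD}
    (hcoef : CoefBoxOK shifts (q : ℝ) (fun i₁ i₂ i μ => (αq i₁ i₂ i μ : ℝ)) Kb Ka (fun i k => (ωq i k : ℝ)) cB)
    {M : ℤ → ℝ} {t : ℕ → ℝ} {Node Hull : ℕ → (Fin m → ℤ → ℝ) → Prop} {j : ℕ}
    {xD x'D rD r'D ρD ED E1D loD hiD : Array Dyad} {C Cn T : Array (Array Dyad)} {bD mC ρs δD : Dyad}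
    {K A A' Eb Et h : ℚ}
    (hb : 0 ≤ bD.toReal) (hmC : 0 ≤ mC.toReal) (hρs : 0 ≤ ρs.toReal) (hAA' : A < A') (ht : t (j + 1) - t j = (h : ℝ))
    (hchkB : checkB m Kb Ka shifts (cB) bD = true)
    (h2 : checkAbsLe (m * winLen Kb Ka) xD mC = true)
    (h3 : checkRowsLe (m * winLen Kb Ka) C rD ρD = true)
    (hhull : checkHull (m * winLen Kb Ka) ρD ED ρs = true)
    (h6 : checkRowsLe (m * winLen Kb Ka) T rD r'D = true)
    (h8 : checkERecVR m Kb Ka shifts (cB) p (dyadToRat bD) (dyadToRat mC) (dyadToRat ρs) h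
      (dPArr (m * winLen Kb Ka) prec (IntervalD.polyLevelsA (m * winLen Kb Ka) prec
        (IntervalD.jetLevelsA (m * winLen Kb Ka) (pqBoxA Kb Ka prec shifts (cB)) prec
          (pointBoxA (m * winLen Kb Ka) xD) p) p (ofRatRel prec h)) x'D)
      (kappaArr prec (m * winLen Kb Ka) Cn T
        (vcolsJ Kb Ka prec shifts (cB) p
          (IntervalD.jetLevelsA (m * winLen Kb Ka) (pqBoxA Kb Ka prec shifts (cB)) prec
            (hullBoxA (m * winLen Kb Ka) xD ρD ED) p) (ofRatRel prec h) C) rD)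
      (nveArr (m * winLen Kb Ka) (IntervalD.polyLevelsA (m * winLen Kb Ka) prec
        (IntervalD.varJetLevelsA (m * winLen Kb Ka) (pqBoxA Kb Ka prec shifts (cB)) prec
          (IntervalD.jetLevelsA (m * winLen Kb Ka) (pqBoxA Kb Ka prec shifts (cB)) prec
            (hullBoxA (m * winLen Kb Ka) xD ρD ED) p) (symBoxA (m * winLen Kb Ka) ED) p) p (ofRatRel prec h)))
      E1D = true)
    (h9 : checkGuardV (dyadToRat bD) (dyadToRat mC) (dyadToRat ρs) h = true)
    (h13 : checkCoverV m Kb Ka shifts (cB) xD ρD ED loD hiD h A' = true)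
    (h10 : checkLipT m Kb Ka shifts (cB) loD hiD K = true)
    (h11 : checkDefectT m Kb Ka prec shifts αq ωq Eb Et loD hiD Sp Sm δD = true)
    (h12 : checkGronwallK K (dyadToRat δD) h A kexp nexp = true)
    (hN : ∀ y, Node j y → PInParaV Kb Ka (fun i k => (ωq i k : ℝ)) (dvec (n := m * winLen Kb Ka) xD)
      (dmat (n := m * winLen Kb Ka) C) (dvec (n := m * winLen Kb Ka) rD) (dvec (n := m * winLen Kb Ka) ED) y)
    (hH : ∀ u ∈ Icc 0 (h : ℝ), ∀ y q' : Fin m → ℤ → ℝ,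
      ProdTube Kb Ka (fun i k => (ωq i k : ℝ)) (dvec (n := m * winLen Kb Ka) xD) (dvec (n := m * winLen Kb Ka) ρD)
        (dvec (n := m * winLen Kb Ka) ED) (vOf Kb Ka shifts (cB) loD hiD) u q' →
      (∀ i k, -Kb ≤ k → k ≤ Ka → |y i k - q' i k| ≤ (A : ℝ) * (ωq i k : ℝ)) → Hull j y)
    (hN' : ∀ y, PInParaV Kb Ka (fun i k => (ωq i k : ℝ)) (dvec (n := m * winLen Kb Ka) x'D)
      (dmat (n := m * winLen Kb Ka) Cn) (dvec (n := m * winLen Kb Ka) r'D) (fun c => dvec (n := m * winLen Kb Ka) E1D c + (A : ℝ)) y →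
      Node (j + 1) y) :
    StepCert shifts.toFinset (q : ℝ) (fun i₁ i₂ i μ => (αq i₁ i₂ i μ : ℝ)) Kb Ka (Eb : ℝ) (Et : ℝ) M t Node Hull j := by
  have hω' : ∀ i k, (0 : ℝ) < (ωq i k : ℝ) := fun i k => by exact_mod_cast hω i k
  have hKK : 0 ≤ Ka + Kb + 1 := by omega
  have hX : (pointBoxA (m * winLen Kb Ka) xD).size = m * winLen Kb Ka := by simp [pointBoxA]
  have hx := mem_pointBoxA (m * winLen Kb Ka) xD
  have hhmem : IntervalD.mem (t (j + 1) - t j) (ofRatRel prec h) := by rw [ht]; exact mem_ofRatRel prec h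
  have hg := guardV_of_check h9
  have hgr := gronwallK_of_check h12
  have hKδ := nonneg_of_checkGronwallK h12
  have hE := eRecVR_of_check h8 hKK
  simp only [cast_dyadToRat] at hg hgr hKδ hE
  have hAA'r : (A : ℝ) < (A' : ℝ) := by exact_mod_cast hAA'
  have hA0 : (0 : ℝ) ≤ (A : ℝ) := (gronwallBound_nonneg_of_zero hKδ.2 hg.1).trans hgr
  have hA' : 0 < A' := by
    have : (0 : ℝ) < (A' : ℝ) := hA0.trans_lt hAA'r
    exact_mod_cast this
  refine stepCert_of_plohner_mvr (ω := fun i k => (ωq i k : ℝ)) (p := p) hKb hKa hq hω' hb hmC hρs hKδ.1 hKδ.2 hAA'r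
    (by rw [ht]; exact hg.1) (by rw [ht]; exact hg.2) (hB_of_checkB hKb hKa hω' hq hnd hcoef hchkB)
    (hBrow2_of_coefBox hKb hKa hω' hq hnd hcoef)
    (abs_le_of_checkAbsLe h2) (mulVec_le_of_checkRowsLe h3) (hull_le_of_checkHull hhull)
    (abs_TPoly_sub_le_dPArr hKb hKa hnd hcoef p hX hx hhmem x'D)
    (kappa_of_kappaArrJ hKb hKa hnd hcoef p xD ρD ED hhmem C Cn T rD)
    (abs_VPoly_le_nveArr hKb hKa hnd hcoef p xD ρD ED hhmem)
    (mulVec_le_of_checkRowsLe h6) (fun c => by rw [ht]; exact hE c)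
    (pqcN_prod_bound hKb hKa hω' hq hnd hcoef loD hiD)
    (fun c => vRowSum_nonneg hnd loD hiD _ _)
    (fun c => by rw [ht]; exact hG_of_checkCoverV hnd hA' h13 hKK c)
    (fun u hu q' y hq' hnear => inBox_of_checkCoverV hnd hω h13 (by rwa [ht] at hu) hq' hnear)
    (pfieldLip_of_checkLipT hKb hKa hω' hq hcoef h10)
    (pinputDefect_of_checkDefectT prec hnd h𝕊 hq hω hSp hSm h11) (by rw [ht]; exact hgr) hN
    (fun u hu y q' hq' hnear => hH u (by rwa [ht] at hu) y q' hq' hnear) hN'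


/-- **`StepCert j` OF THE DEFINITIONAL MESH (VECTOR LAYOUT, GENERIC COEFFICIENT TABLE) FROM THE TESTS OF RECORD `j` AND THE HAND-OVER TO RECORD `j+1`.**
[cite: Zgliczynski2002C1Lohner, §3–4 (Lohner-type parallelepiped frames and the C¹/variational enclosure); cell certificate format, chain checker, vector remainder] -/
theorem stepCert_of_recGJ (hKb : 0 ≤ Kb) (hKa : 1 ≤ Ka) {shifts : List (ℤ × ℤ × ℤ)} (hnd : shifts.Nodup)
    (h𝕊 : IsNearestNeighbourSet shifts.toFinset) {q : ℚ} (hq : 0 < 1 + (q : ℝ))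
    {αq : Fin m → Fin m → Fin m → ℤ × ℤ × ℤ → ℚ} {ωq : Fin m → ℤ → ℚ} (hω : ∀ i k, 0 < ωq i k)
    {prec p kexp nexp : ℕ} {Sp Sm : IntervalD} (hSp : sqrtCheck prec (1 + q) Sp = true)
    (hSm : sqrtCheck prec (1 / (1 + q)) Sm = true) {cB : Fin m → ℤ → Fin m → Fin m → ℤ × ℤ × ℤ → IntervalD}
    (hcoef : CoefBoxOK shifts (q : ℝ) (fun i₁ i₂ i μ => (αq i₁ i₂ i μ : ℝ)) Kb Ka (fun i k => (ωq i k : ℝ)) cB)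
    {M : ℤ → ℝ} {t : ℕ → ℝ} {rec : ℕ → VRec} {j : ℕ}
    {bD : Dyad} {Eb Et : ℚ}
    (hb : 0 ≤ bD.toReal) (hmC : 0 ≤ (rec j).mC.toReal) (hρs : 0 ≤ (rec j).ρs.toReal)
    (hAA' : (rec j).A < (rec j).A') (ht : t (j + 1) - t j = ((rec j).h : ℝ))
    (hnext : checkHandsOverV (m * winLen Kb Ka) (rec j) (rec (j + 1)) = true)
    (hchkB : checkB m Kb Ka shifts (cB) bD = true)
    (h2 : checkAbsLe (m * winLen Kb Ka) (rec j).x (rec j).mC = true)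
    (h3 : checkRowsLe (m * winLen Kb Ka) (rec j).C (rec j).r (rec j).ρ = true)
    (hhull : checkHull (m * winLen Kb Ka) (rec j).ρ (rec j).E (rec j).ρs = true)
    (h6 : checkRowsLe (m * winLen Kb Ka) (rec j).T (rec j).r (rec j).r' = true)
    (h8 : checkERecVR m Kb Ka shifts (cB) p (dyadToRat bD) (dyadToRat (rec j).mC) (dyadToRat (rec j).ρs) (rec j).h
      (dPArr (m * winLen Kb Ka) prec (IntervalD.polyLevelsA (m * winLen Kb Ka) prec
        (IntervalD.jetLevelsA (m * winLen Kb Ka) (pqBoxA Kb Ka prec shifts (cB)) prec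
          (pointBoxA (m * winLen Kb Ka) (rec j).x) p) p (ofRatRel prec (rec j).h)) (rec j).x')
      (kappaArr prec (m * winLen Kb Ka) (rec j).Cn (rec j).T
        (vcolsJ Kb Ka prec shifts (cB) p
          (IntervalD.jetLevelsA (m * winLen Kb Ka) (pqBoxA Kb Ka prec shifts (cB)) prec
            (hullBoxA (m * winLen Kb Ka) (rec j).x (rec j).ρ (rec j).E) p) (ofRatRel prec (rec j).h) (rec j).C) (rec j).r)
      (nveArr (m * winLen Kb Ka) (IntervalD.polyLevelsA (m * winLen Kb Ka) prec
        (IntervalD.varJetLevelsA (m * winLen Kb Ka) (pqBoxA Kb Ka prec shifts (cB)) prec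
          (IntervalD.jetLevelsA (m * winLen Kb Ka) (pqBoxA Kb Ka prec shifts (cB)) prec
            (hullBoxA (m * winLen Kb Ka) (rec j).x (rec j).ρ (rec j).E) p) (symBoxA (m * winLen Kb Ka) (rec j).E) p) p
          (ofRatRel prec (rec j).h)))
      (rec j).E1 = true)
    (h9 : checkGuardV (dyadToRat bD) (dyadToRat (rec j).mC) (dyadToRat (rec j).ρs) (rec j).h = true)
    (h13 : checkCoverV m Kb Ka shifts (cB) (rec j).x (rec j).ρ (rec j).E (rec j).lo (rec j).hi (rec j).h
      (rec j).A' = true)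
    (h10 : checkLipT m Kb Ka shifts (cB) (rec j).lo (rec j).hi (rec j).K = true)
    (h11 : checkDefectT m Kb Ka prec shifts αq ωq Eb Et (rec j).lo (rec j).hi Sp Sm (rec j).δ = true)
    (h12 : checkGronwallK (rec j).K (dyadToRat (rec j).δ) (rec j).h (rec j).A kexp nexp = true) :
    StepCert shifts.toFinset (q : ℝ) (fun i₁ i₂ i μ => (αq i₁ i₂ i μ : ℝ)) Kb Ka (Eb : ℝ) (Et : ℝ) M t
      (nodeOfV Kb Ka ωq rec) (hullOfG Kb Ka shifts cB ωq rec) j := by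
  refine stepCert_of_checksGJ hKb hKa hnd h𝕊 hq hω hSp hSm hcoef hb hmC hρs hAA' ht hchkB h2 h3 hhull h6 h8 h9 h13 h10 h11 h12 (fun _ hy => hy)
    (fun u hu _ q' hq' hnear => ?_) (fun _ hy => node_of_checkHandsOverV hnext hy)
  exact ⟨u, hu, q', hq', hnear⟩


/-! ### One Boolean test per step -/

/-- **ALL TESTS OF VECTOR-LAYOUT STEP `j` OVER THE TABLE `cB`** (signs, hand-over, C2, C3v, hull radii, C6v, C8vr, C9v, cover C13v, K-table, defect table, Grönwall) as
one Boolean. [folklore] -/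
def checkStepGJ (m : ℕ) (Kb Ka : ℤ) (prec p kexp nexp : ℕ) (shifts : List (ℤ × ℤ × ℤ))
    (cB : Fin m → ℤ → Fin m → Fin m → ℤ × ℤ × ℤ → IntervalD)
    (αq : Fin m → Fin m → Fin m → ℤ × ℤ × ℤ → ℚ) (ωq : Fin m → ℤ → ℚ) (Sp Sm : IntervalD) (bD : Dyad) (Eb Et : ℚ)
    (rec : ℕ → VRec) (j : ℕ) : Bool :=
  let n := m * winLen Kb Ka
  let s := rec j
  let hI := ofRatRel prec s.h
  let JX := IntervalD.jetLevelsA n (pqBoxA Kb Ka prec shifts cB) prec (pointBoxA n s.x) p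
  let JH := IntervalD.jetLevelsA n (pqBoxA Kb Ka prec shifts cB) prec (hullBoxA n s.x s.ρ s.E) p
  Dyad.ble (Dyad.ofInt 0) s.mC && Dyad.ble (Dyad.ofInt 0) s.ρs && decide (s.A < s.A') && decide (0 < s.h) &&
  checkHandsOverV n s (rec (j + 1)) &&
  checkAbsLe n s.x s.mC && checkRowsLe n s.C s.r s.ρ && checkHull n s.ρ s.E s.ρs && checkRowsLe n s.T s.r s.r' &&
  checkERecVR m Kb Ka shifts cB p (dyadToRat bD) (dyadToRat s.mC) (dyadToRat s.ρs) s.h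
    (dPArr n prec (IntervalD.polyLevelsA n prec JX p hI) s.x')
    (kappaArr prec n s.Cn s.T (vcolsJ Kb Ka prec shifts cB p JH hI s.C) s.r)
    (nveArr n (IntervalD.polyLevelsA n prec (IntervalD.varJetLevelsA n (pqBoxA Kb Ka prec shifts cB) prec JH (symBoxA n s.E) p) p hI))
    s.E1 &&
  checkGuardV (dyadToRat bD) (dyadToRat s.mC) (dyadToRat s.ρs) s.h &&
  checkCoverV m Kb Ka shifts cB s.x s.ρ s.E s.lo s.hi s.h s.A' &&
  checkLipT m Kb Ka shifts cB s.lo s.hi s.K &&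
  checkDefectT m Kb Ka prec shifts αq ωq Eb Et s.lo s.hi Sp Sm s.δ &&
  checkGronwallK s.K (dyadToRat s.δ) s.h s.A kexp nexp

/-- **`StepCert` OF STEP `j` FROM THE TWO BOOLEANS** `checkGlobalG` and `checkStepGJJ … j` (plus `CoefBoxOK` of the table), on the mesh `tOfV rec`.
[cite: Zgliczynski2002C1Lohner, §3–4 (Lohner-type parallelepiped frames and the C¹/variational enclosure); cell certificate format, branch checker, vector remainder] -/
theorem stepCert_of_checkStepGJ (hKb : 0 ≤ Kb) (hKa : 1 ≤ Ka) {shifts : List (ℤ × ℤ × ℤ)} (hnd : shifts.Nodup)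
    (h𝕊 : IsNearestNeighbourSet shifts.toFinset) {q : ℚ} {cB : Fin m → ℤ → Fin m → Fin m → ℤ × ℤ × ℤ → IntervalD}
    {αq : Fin m → Fin m → Fin m → ℤ × ℤ × ℤ → ℚ} {ωq : Fin m → ℤ → ℚ} (hω : ∀ i k, 0 < ωq i k)
    (hcoef : CoefBoxOK shifts (q : ℝ) (fun i₁ i₂ i μ => (αq i₁ i₂ i μ : ℝ)) Kb Ka (fun i k => (ωq i k : ℝ)) cB)
    {prec p kexp nexp : ℕ} {Sp Sm : IntervalD} {bD : Dyad} {Eb Et : ℚ} {M : ℤ → ℝ} {rec : ℕ → VRec} {j : ℕ}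
    (hg : checkGlobalG m Kb Ka prec shifts cB q Sp Sm bD = true)
    (hs : checkStepGJ m Kb Ka prec p kexp nexp shifts cB αq ωq Sp Sm bD Eb Et rec j = true) :
    StepCert shifts.toFinset (q : ℝ) (fun i₁ i₂ i μ => (αq i₁ i₂ i μ : ℝ)) Kb Ka (Eb : ℝ) (Et : ℝ) M (tOfV rec)
      (nodeOfV Kb Ka ωq rec) (hullOfG Kb Ka shifts cB ωq rec) j := by
  simp only [checkGlobalG, Bool.and_eq_true, decide_eq_true_eq, Dyad.ble_iff, Dyad.toReal_ofInt, Int.cast_zero] at hg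
  obtain ⟨⟨⟨⟨hSp, hSm⟩, hq⟩, hb⟩, hchkB⟩ := hg
  simp only [checkStepGJ, Bool.and_eq_true, decide_eq_true_eq, Dyad.ble_iff, Dyad.toReal_ofInt, Int.cast_zero] at hs
  obtain ⟨⟨⟨⟨⟨⟨⟨⟨⟨⟨⟨⟨⟨⟨hmC, hρs⟩, hAA'⟩, hh⟩, hho⟩, h2⟩, h3⟩, hhull⟩, h6⟩, h8⟩, h9⟩, h13⟩, h10⟩, h11⟩, h12⟩ := hs
  have hq' : 0 < 1 + (q : ℝ) := by
    have : ((-1 : ℚ) : ℝ) < (q : ℝ) := by exact_mod_cast hq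
    push_cast at this; linarith
  exact stepCert_of_recGJ hKb hKa hnd h𝕊 hq' hω hSp hSm hcoef hb hmC hρs hAA' (tOfV_succ_sub rec j) hho hchkB h2 h3 hhull h6 h8 h9 h13 h10
    h11 h12

/-- **THE PER-BRANCH PACKAGE FOR A TRANSIT BRANCH (GENERIC TABLE)**: tests of steps `0 … N−1` and their transit tests ⇒ the mesh facts `ht0`, `hmono`,
the step certificates `hstep` and the hull bound `hhull` of glue XXII `htrap_of_branchMeshes` for this branch. [folklore] -/
theorem transitBranchGJ_of_checks (hKb : 0 ≤ Kb) (hKa : 1 ≤ Ka) {shifts : List (ℤ × ℤ × ℤ)} (hnd : shifts.Nodup)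
    (h𝕊 : IsNearestNeighbourSet shifts.toFinset) {q : ℚ} {cB : Fin m → ℤ → Fin m → Fin m → ℤ × ℤ × ℤ → IntervalD}
    {αq : Fin m → Fin m → Fin m → ℤ × ℤ × ℤ → ℚ} {ωq : Fin m → ℤ → ℚ} (hω : ∀ i k, 0 < ωq i k)
    (hcoef : CoefBoxOK shifts (q : ℝ) (fun i₁ i₂ i μ => (αq i₁ i₂ i μ : ℝ)) Kb Ka (fun i k => (ωq i k : ℝ)) cB)
    {prec p kexp nexp : ℕ} {Sp Sm : IntervalD} {bD : Dyad} {Eb Et : ℚ} {Mq : ℤ → ℚ} {rec : ℕ → VRec} {N : ℕ}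
    (hg : checkGlobalG m Kb Ka prec shifts cB q Sp Sm bD = true)
    (hs : ∀ j, j < N → checkStepGJ m Kb Ka prec p kexp nexp shifts cB αq ωq Sp Sm bD Eb Et rec j = true)
    (htr : ∀ j, j < N → checkTransit m Kb Ka ωq Mq (rec j).lo (rec j).hi = true) :
    tOfV rec 0 = 0 ∧ (∀ j, j < N → tOfV rec j < tOfV rec (j + 1)) ∧
    (∀ j, j < N → StepCert shifts.toFinset (q : ℝ) (fun i₁ i₂ i μ => (αq i₁ i₂ i μ : ℝ)) Kb Ka (Eb : ℝ) (Et : ℝ)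
      (fun k => (Mq k : ℝ)) (tOfV rec) (nodeOfV Kb Ka ωq rec) (hullOfG Kb Ka shifts cB ωq rec) j) ∧
    (∀ j, j < N → ∀ y, hullOfG Kb Ka shifts cB ωq rec j y → ∀ i k, -Kb ≤ k → k ≤ Ka → |y i k| < (Mq k : ℝ)) := by
  refine ⟨tOfV_zero rec, fun j hj => ?_, fun j hj => stepCert_of_checkStepGJ hKb hKa hnd h𝕊 hω hcoef hg (hs j hj), fun j hj y hy => ?_⟩
  · have h := hs j hj
    simp only [checkStepGJ, Bool.and_eq_true, decide_eq_true_eq] at h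
    exact tOfV_lt_succ h.1.1.1.1.1.1.1.1.1.1.1.2
  · have h := hs j hj
    simp only [checkStepGJ, Bool.and_eq_true, decide_eq_true_eq] at h
    have hAA' : (rec j).A ≤ (rec j).A' := le_of_lt h.1.1.1.1.1.1.1.1.1.1.1.1.2
    exact hullBound_of_checkTransitG hnd hω hAA' h.1.1.1.2 (htr j hj) hy

/-! ### The trapping clause from checked transit branch chains -/

variable {ι : Type*} {Core : (Fin m → ℤ → ℝ) → Prop} {w : ℤ → ℝ} {r : ℝ}

/-- **THE TRAPPING CLAUSE `htrap` FROM CHECKED TRANSIT BRANCH CHAINS (GENERIC TABLE).** Per branch `b`: records `rec b`, `N b` steps with `checkStepGJ`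
and `checkTransit` passing, the clock `c ≤ Σ_{j<N b} h`, the start frame the identity with a nonnegative remainder vector; globally `checkGlobal`; and
the fattened core covered by the weighted start boxes ⇒ `htrap` (open `M`-box `M k = Mq k`, clock `c`, edge bounds `Eb`, `Et`).
[cite: Tao2016AveragedNS, §6.3–6.4 Props. 6.4–6.5 (statement shape of a renormalisation certificate); cell certificate format, branch checker, vector remainder] -/
theorem htrap_of_chainChecksGJ (hKb : 0 ≤ Kb) (hKa : 1 ≤ Ka) {shifts : List (ℤ × ℤ × ℤ)} (hnd : shifts.Nodup)
    (h𝕊 : IsNearestNeighbourSet shifts.toFinset) {q : ℚ} {cB : Fin m → ℤ → Fin m → Fin m → ℤ × ℤ × ℤ → IntervalD}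
    {αq : Fin m → Fin m → Fin m → ℤ × ℤ × ℤ → ℚ} {ωq : Fin m → ℤ → ℚ} (hω : ∀ i k, 0 < ωq i k)
    (hcoef : CoefBoxOK shifts (q : ℝ) (fun i₁ i₂ i μ => (αq i₁ i₂ i μ : ℝ)) Kb Ka (fun i k => (ωq i k : ℝ)) cB)
    {prec p kexp nexp : ℕ} {Sp Sm : IntervalD} {bD : Dyad} {Eb Et c : ℚ} {Mq : ℤ → ℚ}
    {rec : ι → ℕ → VRec} {N : ι → ℕ}
    (hg : checkGlobalG m Kb Ka prec shifts cB q Sp Sm bD = true)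
    (hs : ∀ b j, j < N b → checkStepGJ m Kb Ka prec p kexp nexp shifts cB αq ωq Sp Sm bD Eb Et (rec b) j = true)
    (htr : ∀ b j, j < N b → checkTransit m Kb Ka ωq Mq (rec b j).lo (rec b j).hi = true)
    (hc : ∀ b, c ≤ sumHV (rec b) (N b))
    (hid : ∀ b, checkIdFrame (m * winLen Kb Ka) (rec b 0).C = true) (hE : ∀ b, checkNonneg (m * winLen Kb Ka) (rec b 0).E = true)
    (hcover : ∀ (z S₀ : Fin m → ℤ → ℝ), Core z → (∀ i k, -Kb ≤ k → k ≤ Ka → w k * |S₀ i k - z i k| ≤ r) →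
      ∃ b, ∀ d, |pxcoord Kb Ka (fun i k => (ωq i k : ℝ)) S₀ d - dvec (n := m * winLen Kb Ka) (rec b 0).x d| ≤
        dvec (n := m * winLen Kb Ka) (rec b 0).r d) :
    ∀ (s : ℝ) (z : Fin m → ℤ → ℝ) (S : Fin m → ℤ → ℝ → ℝ), Core z → 0 < s → s ≤ (c : ℝ) →
      (∀ i k, -Kb ≤ k → k ≤ Ka → w k * |S i k 0 - z i k| ≤ r) →
      (∀ i k, -Kb ≤ k → k ≤ Ka → ∀ u ∈ Icc 0 s,
        HasDerivWithinAt (S i k) (quadTermOn shifts.toFinset (q : ℝ) (fun i₁ i₂ i μ => (αq i₁ i₂ i μ : ℝ)) S i k u) (Icc 0 s) u) →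
      (∀ i, ContinuousOn (S i (-Kb - 1)) (Icc 0 s)) → (∀ i, ContinuousOn (S i (Ka + 1)) (Icc 0 s)) →
      (∀ i, ∀ u ∈ Icc 0 s, |S i (-Kb - 1) u| ≤ (Eb : ℝ)) →
      (∀ i, ∀ u ∈ Icc 0 s, |S i (Ka + 1) u| ≤ (Et : ℝ)) →
      (∀ i k, -Kb ≤ k → k ≤ Ka → ∀ u ∈ Icc 0 s, |S i k u| ≤ (Mq k : ℝ)) →
        ∀ i k, -Kb ≤ k → k ≤ Ka → ∀ u ∈ Icc 0 s, |S i k u| < (Mq k : ℝ) := by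
  have hbr := fun b => transitBranchGJ_of_checks hKb hKa hnd h𝕊 hω hcoef hg (hs b) (htr b)
  exact htrap_of_branchMeshes
    (Box := fun b S₀ => ∀ d, |pxcoord Kb Ka (fun i k => (ωq i k : ℝ)) S₀ d - dvec (n := m * winLen Kb Ka) (rec b 0).x d| ≤
      dvec (n := m * winLen Kb Ka) (rec b 0).r d)
    (t := fun b => tOfV (rec b)) (Node := fun b => nodeOfV Kb Ka ωq (rec b))
    (Hull := fun b => hullOfG Kb Ka shifts cB ωq (rec b))
    hcover (fun b => (hbr b).1) (fun b => (hbr b).2.1) (fun b => le_tOfV_of_le_sumHV (hc b))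
    (fun b y hy => node0_of_boxV (hid b) (hE b) hy) (fun b => (hbr b).2.2.1) (fun b => (hbr b).2.2.2)


end CertificateGlueOn

end Summit.NavierStokesRegularity.NavierStokesRegularity.Theorems
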